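import Mathlib
import Literature.MathematicalPhysics.QuantumFieldTheory.Balaban1983to89.Beta.AveragingMixedJetTables
import Summits.QuantumFields.BalabanUV.Beta.MultilinearJetUnique
import Summits.QuantumFields.BalabanUV.Beta.MultilinearJetExpLog

/-!
# MultilinearJetAveraging — node 12/12b's averaged jets `QjetAt`, `T2At`, `MjetAt` ARE the multilinear Taylor
coefficients of the genuine Banach-algebra one-step averaging (an1 node 12c, part 3 of 4: the identification)

HONEST FRAMING.  Discharging `BetaPertH` would make Bałaban's UV stability UNCONDITIONAL — a constructive-QFT
result; it is NOT the continuum limit and NOT the Clay problem.  This file discharges nothing of it and moves no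
binder of the WALL: it closes the gap node 12's header records verbatim («the link "truncated series = 3-jet of the
true map" is NOT typed here»).  ABSOLUTE RULE respected: nothing is cited; the manuscripts under audit are not
invoked; every statement below is proved from the definitions ([folklore] calculus).

## Content

* §1 `PhiA ρ U Ū L μ y` — the GENUINE rooted one-step covariant averaging (15)/(42) of an `𝔸`-valued transporter pair
  in a complete normed `ℂ`-algebra: `exp (L^{−d} Σ_{x ∈ B(y)} log hol(Γ^ρ_{c,x} ∪ (−c))) · hol(c)` with the true
  `exp` (`NormedSpace.exp`) and `log = logOnePlus (· − 1)`; and the GENERIC JET THEOREM `PhiGAt_mem_jets`: if a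
  3-parameter family of transporter pairs has letterwise jets `(𝒢, 𝒢̄)` (part 1's `jets`), augmentation `1`, then
  node 12b's formal `PhiGAt ℂ ρ 𝒢 𝒢̄` IS the jet of `x ↦ PhiA ρ (U x) (Ū x)` (holonomies by the product rule, the
  block average by linearity, `exp ∘ log` by part 2).
* §2 the two charts as genuine exponential families: PRODUCT chart `U_f(s,t₁,t₂) = e^{sW_f} e^{t₁B_f} e^{t₂B′_f}`
  (jet = node 12's `Gf (upF W) B B′`, backward `Gb`), MIXED chart `e^{t₁W_f + t₂V_f} e^{sB_f}` (jet = 12b's `Gm`, `Gmb`).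
* §3 THE IDENTIFICATION: `ρ · QjetAt ℂ ρ (upF W) B B′ L μ y` is the (unique, part 1b) multilinear 3-jet at `0` of
  `(s,t₁,t₂) ↦ log( Φ^ρ_b(U(s,t₁,t₂)) · Φ^ρ_b(U(0,t₁,t₂))⁻¹ )`; hence `T2At` is the sum of the `s t₁ t₂`-Taylor
  coefficients for `(B,B′)` and `(B′,B)`, and `MjetAt` is the `s t₁ t₂`-coefficient of the mixed-chart analogue.
-/

noncomputable section

set_option synthInstance.maxHeartbeats 400000

open scoped Topology
open Filter Finset
open Literature.MathematicalPhysics.QuantumFieldTheory.Balaban1983to89.Beta.AffineAveraging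
open Literature.MathematicalPhysics.QuantumFieldTheory.Balaban1983to89.Beta.AveragingContours
open Literature.MathematicalPhysics.QuantumFieldTheory.Balaban1983to89.Beta.AveragingContoursRooted
open Literature.MathematicalPhysics.QuantumFieldTheory.Balaban1983to89.Beta.AveragingHessianKernels
open Literature.MathematicalPhysics.QuantumFieldTheory.Balaban1983to89.Beta.AveragingThirdJet
open Literature.MathematicalPhysics.QuantumFieldTheory.Balaban1983to89.Beta.AveragingThirdJet.Tau
open Literature.MathematicalPhysics.QuantumFieldTheory.Balaban1983to89.Beta.AveragingMixedJetTables
open Literature.Analysis.Complex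

namespace Summit.QuantumFields.BalabanUV.Beta.MultilinearJet

variable {𝔸 : Type*} [NormedRing 𝔸] [NormedAlgebra ℂ 𝔸] [CompleteSpace 𝔸] {d : ℕ}

/-! ## §1 The genuine averaging map and the generic jet theorem -/

/-- [folklore] THE GENUINE ROOTED ONE-STEP COVARIANT AVERAGING (15)/(42) of an `𝔸`-valued transporter pair `(U, Ū)`:
`Φ^ρ_b = exp( L^{−d} Σ_{x ∈ B(y)} log hol(Γ^ρ_{c,x} ∪ (−c)) ) · hol(c)` — node 12b's `PhiGAt` with the TRUE
exponential and logarithm of the Banach algebra in place of the truncated `expT`, `logT`. -/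
def PhiA (ρ : Fin d → ℤ) (U Ub : Form1 d 𝔸) (L : ℕ) (μ : Fin d) (y : Fin d → ℤ) : 𝔸 :=
  NormedSpace.exp (((L : ℂ) ^ d)⁻¹ • ∑ b ∈ box d L, logOnePlus (holG U Ub (loopCAt ρ δ L μ y b) - 1))
    * holG U Ub (segUp δ ((L : ℤ) • y + ρ) μ L)

section Generic

variable {G Gb : P3 → Form1 d 𝔸} {𝒢 𝒢b : Form1 d (Rho 𝔸)}

omit [CompleteSpace 𝔸] in
/-- [folklore] HOLONOMY JETS: letterwise jets multiply along any list of oriented bonds (part 1's product rule). -/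
theorem holG_mem_jets (hG : ∀ κ z, 𝒢 κ z ∈ jets (fun x => G x κ z))
    (hGb : ∀ κ z, 𝒢b κ z ∈ jets (fun x => Gb x κ z)) {P : (Fin d → ℤ) → Prop} {l : List (LetterGrp d)}
    (hl : LettersIn δ P l) : holG 𝒢 𝒢b l ∈ jets (fun x => holG (G x) (Gb x) l) := by
  induction l with
  | nil => simpa using (one_mem_jets (𝔸 := 𝔸))
  | cons a l ih =>
    have ih' := ih fun b hb => hl b (List.mem_cons_of_mem a hb)
    obtain ⟨κ, z, -, h | h⟩ := hl a List.mem_cons_self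
    · subst h; simpa only [holG_cons, realize_delta] using mul_mem_jets (hG κ z) ih'
    · subst h; simpa only [holG_cons, realize_neg_delta] using mul_mem_jets (hGb κ z) ih'

omit [CompleteSpace 𝔸] in
/-- [folklore] Augmentation of a holonomy of augmentation-`1` letters. -/
theorem augR_holG (hG1 : ∀ κ z, c00 (𝒢 κ z).fst = 1) (hGb1 : ∀ κ z, c00 (𝒢b κ z).fst = 1)
    {P : (Fin d → ℤ) → Prop} {l : List (LetterGrp d)} (hl : LettersIn δ P l) :
    c00 (holG 𝒢 𝒢b l).fst = 1 := by
  have e := map_holG (augR ℂ) 𝒢 𝒢b l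
  simp only [augR_apply, hG1, hGb1] at e
  rw [e]; exact holG_one hl

omit [CompleteSpace 𝔸] in
/-- [folklore] The truncated logarithm of an augmentation-`1` element has augmentation `0`. -/
theorem c00_fst_logT {q : Rho 𝔸} (h : c00 q.fst = 1) : c00 (logT ℂ q).fst = 0 := by
  rw [logT]; simp [h]

/-- [folklore] THE GENERIC JET THEOREM: node 12b's formal rooted averaging `PhiGAt ℂ ρ 𝒢 𝒢̄` of the letterwise
jets IS the multilinear 3-jet of the genuine averaging `x ↦ PhiA ρ (U x) (Ū x)`. -/
theorem PhiGAt_mem_jets (ρ : Fin d → ℤ) (L : ℕ) (μ : Fin d) (y : Fin d → ℤ)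
    (hG : ∀ κ z, 𝒢 κ z ∈ jets (fun x => G x κ z)) (hGb : ∀ κ z, 𝒢b κ z ∈ jets (fun x => Gb x κ z))
    (hG1 : ∀ κ z, c00 (𝒢 κ z).fst = 1) (hGb1 : ∀ κ z, c00 (𝒢b κ z).fst = 1) :
    PhiGAt ℂ ρ 𝒢 𝒢b L μ y ∈ jets (fun x => PhiA ρ (G x) (Gb x) L μ y) := by
  have hlog : ∀ b ∈ box d L, logT ℂ (holG 𝒢 𝒢b (loopCAt ρ δ L μ y b))
      ∈ jets (fun x => logOnePlus (holG (G x) (Gb x) (loopCAt ρ δ L μ y b) - 1)) := fun b _ =>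
    logOnePlus_mem_jets (holG_mem_jets hG hGb (lettersIn_loopCAt_top ρ δ L μ y b))
      (augR_holG hG1 hGb1 (lettersIn_loopCAt_top ρ δ L μ y b))
  have hsum := smul_mem_jets (((L : ℂ) ^ d)⁻¹) (sum_mem_jets (box d L) hlog)
  have h0 : c00 ((((L : ℂ) ^ d)⁻¹ • ∑ b ∈ box d L, logT ℂ (holG 𝒢 𝒢b (loopCAt ρ δ L μ y b))).fst) = 0 := by
    rw [TrivSqZeroExt.fst_smul, c00_smul, TrivSqZeroExt.fst_sum, c00_sum,
      Finset.sum_eq_zero fun b hb => c00_fst_logT (augR_holG hG1 hGb1 (lettersIn_loopCAt_top ρ δ L μ y b)),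
      smul_zero]
  have hexp := exp_mem_jets hsum h0
  have hc := holG_mem_jets hG hGb (lettersIn_segUp_top δ ((L : ℤ) • y + ρ) μ L)
  have h := mul_mem_jets hexp hc
  rw [PhiGAt]
  simpa only [PhiA, Finset.smul_sum] using h

omit [CompleteSpace 𝔸] in
/-- [folklore] Augmentation of the formal averaging of augmentation-`1` letters. -/
theorem augR_PhiGAt (ρ : Fin d → ℤ) (L : ℕ) (μ : Fin d) (y : Fin d → ℤ)
    (hG1 : ∀ κ z, c00 (𝒢 κ z).fst = 1) (hGb1 : ∀ κ z, c00 (𝒢b κ z).fst = 1) :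
    c00 (PhiGAt ℂ ρ 𝒢 𝒢b L μ y).fst = 1 := by
  have e := map_PhiGAt (augR ℂ) ρ 𝒢 𝒢b L μ y
  simp only [augR_apply, hG1, hGb1] at e
  rw [e]; exact PhiGAt_one ρ L μ y

end Generic

/-! ## §2 The product and mixed charts as genuine exponential families, and their letter jets -/

section Charts

omit [NormedAlgebra ℂ 𝔸] [CompleteSpace 𝔸] in
/-- Products of pure-background dual numbers. -/
theorem dmk_zero_mul (a b : Tau 𝔸) : dmk a (0 : Tau 𝔸) * dmk b 0 = dmk (a * b) 0 :=
  TrivSqZeroExt.ext (by simp) (by simp)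

omit [CompleteSpace 𝔸] in
/-- `expT` of a pure-background letter with square-zero exponent: `expT (a, 0) = (1 + a, 0)`. -/
theorem expT_dmk_of_sq {a : Tau 𝔸} (h : a * a = 0) : expT ℂ (dmk a (0 : Tau 𝔸)) = dmk (1 + a) 0 := by
  have h2 : dmk a (0 : Tau 𝔸) * dmk a 0 = 0 := by rw [dmk_zero_mul, h]; exact TrivSqZeroExt.ext rfl rfl
  rw [expT, h2, zero_mul, smul_zero, smul_zero, add_zero, add_zero]
  exact TrivSqZeroExt.ext (by simp) (by simp)

omit [CompleteSpace 𝔸] in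
/-- `expT` of a pure-background letter with cube-zero exponent: `expT (a, 0) = (1 + a + a²/2, 0)`. -/
theorem expT_dmk_of_cube {a : Tau 𝔸} (h : a * a * a = 0) :
    expT ℂ (dmk a (0 : Tau 𝔸)) = dmk (1 + a + (2 : ℂ)⁻¹ • (a * a)) 0 := by
  have h3 : dmk a (0 : Tau 𝔸) * dmk a 0 * dmk a 0 = 0 := by
    rw [dmk_zero_mul, dmk_zero_mul, h]; exact TrivSqZeroExt.ext rfl rfl
  rw [expT, h3, smul_zero, add_zero, dmk_zero_mul]
  exact TrivSqZeroExt.ext (by simp) (by simp)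

omit [NormedAlgebra ℂ 𝔸] [CompleteSpace 𝔸] in
/-- The letters `τᵢ · ι b` square to zero. -/
theorem τ₁ι_sq (b : 𝔸) : (τ₁ * ι b) * (τ₁ * ι b) = 0 := ext4 (by simp) (by simp) (by simp) (by simp)

omit [NormedAlgebra ℂ 𝔸] [CompleteSpace 𝔸] in
/-- (see `τ₁ι_sq`) -/
theorem τ₂ι_sq (b : 𝔸) : (τ₂ * ι b) * (τ₂ * ι b) = 0 := ext4 (by simp) (by simp) (by simp) (by simp)

/-- [folklore] `e^{sW}` has jet `1 + ρ W` (node 12's fluctuation letter `X_f`). -/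
theorem exp_s_mem_jets (w : 𝔸) : dmk 1 (ι w) ∈ jets (fun x : P3 => NormedSpace.exp ((x 0) • w)) := by
  have h := exp_mem_jets (smul_s_mem_jets w) (by simp)
  rwa [expT_dmk_zero] at h

/-- [folklore] `e^{−sW}` has jet `1 − ρ W` (`X_f⁻¹`). -/
theorem exp_neg_s_mem_jets (w : 𝔸) : dmk 1 (-ι w) ∈ jets (fun x : P3 => NormedSpace.exp (-((x 0) • w))) := by
  have e : -(dmk (0 : Tau 𝔸) (ι w)) = dmk 0 (-ι w) := TrivSqZeroExt.ext (by simp) (by simp)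
  have h := exp_mem_jets (neg_mem_jets (smul_s_mem_jets w)) (by simp)
  rwa [e, expT_dmk_zero] at h

/-- [folklore] `e^{t₁B}` has jet `1 + τ₁ B`. -/
theorem exp_t1_mem_jets (b : 𝔸) : dmk (1 + τ₁ * ι b) 0 ∈ jets (fun x : P3 => NormedSpace.exp ((x 1) • b)) := by
  have h := exp_mem_jets (smul_t1_mem_jets b) (by simp)
  rwa [expT_dmk_of_sq (τ₁ι_sq b)] at h

/-- [folklore] `e^{t₂B′}` has jet `1 + τ₂ B′`. -/
theorem exp_t2_mem_jets (b : 𝔸) : dmk (1 + τ₂ * ι b) 0 ∈ jets (fun x : P3 => NormedSpace.exp ((x 2) • b)) := by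
  have h := exp_mem_jets (smul_t2_mem_jets b) (by simp)
  rwa [expT_dmk_of_sq (τ₂ι_sq b)] at h

/-- [folklore] `e^{−t₁B}` has jet `1 − τ₁ B`. -/
theorem exp_neg_t1_mem_jets (b : 𝔸) :
    dmk (1 - τ₁ * ι b) 0 ∈ jets (fun x : P3 => NormedSpace.exp (-((x 1) • b))) := by
  have e : -(dmk (τ₁ * ι b) (0 : Tau 𝔸)) = dmk (-(τ₁ * ι b)) 0 := TrivSqZeroExt.ext (by simp) (by simp)
  have hsq : (-(τ₁ * ι b)) * (-(τ₁ * ι b)) = 0 := by rw [neg_mul_neg, τ₁ι_sq]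
  rw [sub_eq_add_neg, ← expT_dmk_of_sq hsq, ← e]
  exact exp_mem_jets (neg_mem_jets (smul_t1_mem_jets b)) (by simp)

/-- [folklore] `e^{−t₂B′}` has jet `1 − τ₂ B′`. -/
theorem exp_neg_t2_mem_jets (b : 𝔸) :
    dmk (1 - τ₂ * ι b) 0 ∈ jets (fun x : P3 => NormedSpace.exp (-((x 2) • b))) := by
  have e : -(dmk (τ₂ * ι b) (0 : Tau 𝔸)) = dmk (-(τ₂ * ι b)) 0 := TrivSqZeroExt.ext (by simp) (by simp)
  have hsq : (-(τ₂ * ι b)) * (-(τ₂ * ι b)) = 0 := by rw [neg_mul_neg, τ₂ι_sq]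
  rw [sub_eq_add_neg, ← expT_dmk_of_sq hsq, ← e]
  exact exp_mem_jets (neg_mem_jets (smul_t2_mem_jets b)) (by simp)

/-- [folklore] `e^{t₁W + t₂V}` has jet 12b's symmetric letter `Z_f = 1 + τ₁W + τ₂V + ½τ₁τ₂(WV + VW)`. -/
theorem exp_t1_t2_mem_jets (W V : Form1 d 𝔸) (κ : Fin d) (z : Fin d → ℤ) : dmk (Zf ℂ W V κ z) 0
    ∈ jets (fun x : P3 => NormedSpace.exp ((x 1) • W κ z + (x 2) • V κ z)) := by
  set a : Tau 𝔸 := τ₁ * ι (W κ z) + τ₂ * ι (V κ z) with ha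
  have e : dmk (τ₁ * ι (W κ z)) (0 : Tau 𝔸) + dmk (τ₂ * ι (V κ z)) 0 = dmk a 0 :=
    TrivSqZeroExt.ext (by simp [ha]) (by simp)
  have h3 : a * a * a = 0 := mul3_eq_zero (by simp [ha]) (by simp [ha]) (by simp [ha])
  have hZ : 1 + a + (2 : ℂ)⁻¹ • (a * a) = Zf ℂ W V κ z := by
    simp only [ha, Zf]
    exact ext4 (by simp) (by simp) (by simp) (by simp [smul_add])
  have h := exp_mem_jets (add_mem_jets (smul_t1_mem_jets (W κ z)) (smul_t2_mem_jets (V κ z))) (by simp)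
  rwa [e, expT_dmk_of_cube h3, hZ] at h

/-- [folklore] `e^{−(t₁W + t₂V)}` has jet 12b's `Z̄_f = 1 − τ₁W − τ₂V + ½τ₁τ₂(WV + VW)`. -/
theorem exp_neg_t1_t2_mem_jets (W V : Form1 d 𝔸) (κ : Fin d) (z : Fin d → ℤ) : dmk (Zb ℂ W V κ z) 0
    ∈ jets (fun x : P3 => NormedSpace.exp (-((x 1) • W κ z + (x 2) • V κ z))) := by
  set a : Tau 𝔸 := -(τ₁ * ι (W κ z) + τ₂ * ι (V κ z)) with ha
  have e : -(dmk (τ₁ * ι (W κ z)) (0 : Tau 𝔸) + dmk (τ₂ * ι (V κ z)) 0) = dmk a 0 :=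
    TrivSqZeroExt.ext (by simp [ha]) (by simp)
  have h3 : a * a * a = 0 := mul3_eq_zero (by simp [ha]) (by simp [ha]) (by simp [ha])
  have hZ : 1 + a + (2 : ℂ)⁻¹ • (a * a) = Zb ℂ W V κ z := by
    simp only [ha, Zb]
    exact ext4 (by simp) (by simp) (by simp) (by simp [smul_add])
  have h := exp_mem_jets (neg_mem_jets (add_mem_jets (smul_t1_mem_jets (W κ z)) (smul_t2_mem_jets (V κ z))))
    (by simp)
  rwa [e, expT_dmk_of_cube h3, hZ] at h

variable (W V B B' : Form1 d 𝔸)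

/-- [folklore] THE GENUINE PRODUCT CHART, forward: `U_f(s,t₁,t₂) = e^{sW_f} · e^{t₁B_f} e^{t₂B′_f}`. -/
def Uf (x : P3) : Form1 d 𝔸 := fun κ z =>
  NormedSpace.exp ((x 0) • W κ z) * (NormedSpace.exp ((x 1) • B κ z) * NormedSpace.exp ((x 2) • B' κ z))

/-- [folklore] … backward: `U_f⁻¹ = e^{−t₂B′_f} e^{−t₁B_f} · e^{−sW_f}`. -/
def Ub (x : P3) : Form1 d 𝔸 := fun κ z =>
  NormedSpace.exp (-((x 2) • B' κ z)) * NormedSpace.exp (-((x 1) • B κ z)) * NormedSpace.exp (-((x 0) • W κ z))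

/-- [folklore] THE GENUINE MIXED CHART, forward: `e^{t₁W_f + t₂V_f} · e^{sB_f}`. -/
def Um (x : P3) : Form1 d 𝔸 := fun κ z =>
  NormedSpace.exp ((x 1) • W κ z + (x 2) • V κ z) * NormedSpace.exp ((x 0) • B κ z)

/-- [folklore] … backward: `e^{−sB_f} · e^{−(t₁W_f + t₂V_f)}`. -/
def Umb (x : P3) : Form1 d 𝔸 := fun κ z =>
  NormedSpace.exp (-((x 0) • B κ z)) * NormedSpace.exp (-((x 1) • W κ z + (x 2) • V κ z))

/-- [folklore] Node 12's forward chart letter `Gf (upF W) B B′` IS the jet of the genuine `U_f`. -/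
theorem Gf_mem_jets (κ : Fin d) (z : Fin d → ℤ) : Gf (upF W) B B' κ z ∈ jets (fun x => Uf W B B' x κ z) := by
  have e : Gf (upF W) B B' κ z = dmk 1 (ι (W κ z)) * (dmk (1 + τ₁ * ι (B κ z)) 0 * dmk (1 + τ₂ * ι (B' κ z)) 0) := by
    simp only [Gf, upF_apply, Ebg, dmk_zero_mul]
  rw [e]
  exact mul_mem_jets (exp_s_mem_jets _) (mul_mem_jets (exp_t1_mem_jets _) (exp_t2_mem_jets _))

/-- [folklore] Node 12's backward chart letter `Gb (upF W) B B′` IS the jet of the genuine `U_f⁻¹`. -/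
theorem Gb_mem_jets (κ : Fin d) (z : Fin d → ℤ) : Gb (upF W) B B' κ z ∈ jets (fun x => Ub W B B' x κ z) := by
  have e : Gb (upF W) B B' κ z = dmk (1 - τ₂ * ι (B' κ z)) 0 * dmk (1 - τ₁ * ι (B κ z)) 0 * dmk 1 (-ι (W κ z)) := by
    simp only [Gb, upF_apply, Ebi, dmk_zero_mul]
  rw [e]
  exact mul_mem_jets (mul_mem_jets (exp_neg_t2_mem_jets _) (exp_neg_t1_mem_jets _)) (exp_neg_s_mem_jets _)

/-- [folklore] 12b's forward mixed letter `Gm W V B` IS the jet of the genuine mixed chart. -/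
theorem Gm_mem_jets (κ : Fin d) (z : Fin d → ℤ) : Gm ℂ W V B κ z ∈ jets (fun x => Um W V B x κ z) := by
  have e : Gm ℂ W V B κ z = dmk (Zf ℂ W V κ z) 0 * dmk 1 (ι (B κ z)) :=
    TrivSqZeroExt.ext (by simp [Gm]) (by simp [Gm])
  rw [e]
  exact mul_mem_jets (exp_t1_t2_mem_jets W V κ z) (exp_s_mem_jets _)

/-- [folklore] 12b's backward mixed letter `Gmb W V B` IS the jet of the genuine backward mixed chart. -/
theorem Gmb_mem_jets (κ : Fin d) (z : Fin d → ℤ) : Gmb ℂ W V B κ z ∈ jets (fun x => Umb W V B x κ z) := by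
  have e : Gmb ℂ W V B κ z = dmk 1 (-ι (B κ z)) * dmk (Zb ℂ W V κ z) 0 :=
    TrivSqZeroExt.ext (by simp [Gmb]) (by simp [Gmb])
  rw [e]
  exact mul_mem_jets (exp_neg_s_mem_jets _) (exp_neg_t1_t2_mem_jets W V κ z)

omit [NormedAlgebra ℂ 𝔸] [CompleteSpace 𝔸] in
/-- `upF 0 = 0`. -/
@[simp] theorem upF_zero : upF (0 : Form1 d 𝔸) = 0 := by
  funext κ z; simp [upF]

end Charts

/-! ## §3 The identification of `QjetAt`, `T2At`, `MjetAt` -/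

section Identification

variable (ρ : Fin d → ℤ) (W V B B' : Form1 d 𝔸) (L : ℕ) (μ : Fin d) (y : Fin d → ℤ)

/-- [folklore] Node 12/12b's formal averaged family `PhiRAt ℂ ρ (upF W) B B′` IS the jet of the genuine averaging of
the genuine product chart. -/
theorem PhiRAt_mem_jets :
    PhiRAt ℂ ρ (upF W) B B' L μ y ∈ jets (fun x => PhiA ρ (Uf W B B' x) (Ub W B B' x) L μ y) :=
  PhiGAt_mem_jets ρ L μ y (Gf_mem_jets W B B') (Gb_mem_jets W B B') (fun κ z => by simp) (fun κ z => by simp)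

/-- [folklore] … and the mixed-chart version for 12b's `PhiMAt`. -/
theorem PhiMAt_mem_jets :
    PhiMAt ℂ ρ W V B L μ y ∈ jets (fun x => PhiA ρ (Um W V B x) (Umb W V B x) L μ y) :=
  PhiGAt_mem_jets ρ L μ y (Gm_mem_jets W V B) (Gmb_mem_jets W V B) (fun κ z => by simp [Gm, Zf])
    (fun κ z => by simp [Gmb, Zb])

omit [CompleteSpace 𝔸] in
/-- [folklore] The formal averaged family on the product chart has augmentation `1`. -/
theorem augR_PhiRAt (ω : Form1 d (Tau 𝔸)) : c00 (PhiRAt ℂ ρ ω B B' L μ y).fst = 1 :=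
  augR_PhiGAt (𝒢 := Gf ω B B') (𝒢b := Gb ω B B') ρ L μ y (fun κ z => by simp) (fun κ z => by simp)

omit [CompleteSpace 𝔸] in
/-- [folklore] The formal averaged family on the mixed chart has augmentation `1`. -/
theorem augR_PhiMAt : c00 (PhiMAt ℂ ρ W V B L μ y).fst = 1 :=
  augR_PhiGAt (𝒢 := Gm ℂ W V B) (𝒢b := Gmb ℂ W V B) ρ L μ y (fun κ z => by simp [Gm, Zf])
    (fun κ z => by simp [Gmb, Zb])

omit [CompleteSpace 𝔸] in
/-- [folklore] The background part of `PhiRAt` does not see the fluctuation. -/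
theorem fst_PhiRAt (ω : Form1 d (Tau 𝔸)) :
    (PhiRAt ℂ ρ ω B B' L μ y).fst = PhiGAt ℂ ρ (fun κ x => Ebg B B' κ x) (fun κ x => Ebi B B' κ x) L μ y := by
  have e := map_PhiGAt (TrivSqZeroExt.fstHom ℂ (Tau 𝔸) (Tau 𝔸)) ρ (Gf ω B B') (Gb ω B B') L μ y
  simpa only [PhiRAt, TrivSqZeroExt.fstHom_apply, fst_Gf, fst_Gb] using e

omit [CompleteSpace 𝔸] in
/-- [folklore] `log( Φ · Φ₀⁻¹ )` has NO pure-background part when `Φ`, `Φ₀` share their background part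
(right-trivialisation kills every `s⁰`-coefficient). -/
theorem fst_logT_mul_invT {P P₀ : Rho 𝔸} (h : P.fst = P₀.fst) (h1 : c00 P₀.fst = 1) :
    (logT ℂ (P * invT P₀)).fst = 0 := by
  have e := map_logT (TrivSqZeroExt.fstHom ℂ (Tau 𝔸) (Tau 𝔸)) (P * invT P₀)
  simp only [TrivSqZeroExt.fstHom_apply, map_mul, map_invT] at e
  have h3 : (P₀.fst - 1) * (P₀.fst - 1) * (P₀.fst - 1) = 0 :=
    mul3_eq_zero (by simp [h1]) (by simp [h1]) (by simp [h1])
  rw [e, h, mul_invT, h3, zero_mul, sub_zero, logT_one]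

/-- [folklore] THE IDENTIFICATION OF THE AVERAGED JET.  `ρ · QjetAt ℂ ρ (upF W) B B′ L μ y` (no `s⁰`-part; the four
components `c00, c10, c01, c11` of `QjetAt` as the `s, s t₁, s t₂, s t₁ t₂`-coefficients) is the multilinear 3-jet at `0`
of the GENUINE right-trivialised logarithmic averaging
`(s,t₁,t₂) ↦ log( Φ^ρ_b(U_{W,B,B′}(s,t₁,t₂)) · Φ^ρ_b(U_{0,B,B′}(s,t₁,t₂))⁻¹ )`. -/
theorem dmk_QjetAt_mem_jets : dmk 0 (QjetAt ℂ ρ (upF W) B B' L μ y) ∈ jets (fun x =>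
    logOnePlus (PhiA ρ (Uf W B B' x) (Ub W B B' x) L μ y
      * Ring.inverse (PhiA ρ (Uf 0 B B' x) (Ub 0 B B' x) L μ y) - 1)) := by
  have hU := PhiRAt_mem_jets ρ W B B' L μ y
  have hE := PhiRAt_mem_jets ρ 0 B B' L μ y
  rw [upF_zero] at hE
  have hQ := logOnePlus_mul_inverse_mem_jets hU hE (augR_PhiRAt ρ B B' L μ y (upF W))
    (augR_PhiRAt ρ B B' L μ y 0)
  have hfst : (logT ℂ (PhiRAt ℂ ρ (upF W) B B' L μ y * invT (PhiRAt ℂ ρ 0 B B' L μ y))).fst = 0 :=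
    fst_logT_mul_invT (by rw [fst_PhiRAt, fst_PhiRAt]) (augR_PhiRAt ρ B B' L μ y 0)
  have e : dmk 0 (QjetAt ℂ ρ (upF W) B B' L μ y)
      = logT ℂ (PhiRAt ℂ ρ (upF W) B B' L μ y * invT (PhiRAt ℂ ρ 0 B B' L μ y)) := by
    rw [← hfst, QjetAt, dmk_eq]
  rw [e]; exact hQ

/-- [folklore] … and it is THE jet: any multilinear 3-jet of that genuine function equals `ρ · QjetAt` (part 1b). -/
theorem eq_dmk_QjetAt {q : Rho 𝔸} (hq : q ∈ jets (fun x =>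
    logOnePlus (PhiA ρ (Uf W B B' x) (Ub W B B' x) L μ y
      * Ring.inverse (PhiA ρ (Uf 0 B B' x) (Ub 0 B B' x) L μ y) - 1))) :
    q = dmk 0 (QjetAt ℂ ρ (upF W) B B' L μ y) :=
  mem_jets_unique hq (dmk_QjetAt_mem_jets ρ W B B' L μ y)

/-- [folklore] THE IDENTIFICATION OF `T2At`: the symmetrised second-order background response is the SUM of the
`s t₁ t₂`-Taylor coefficients at `0` of the two genuine functions with backgrounds `(B, B′)` and `(B′, B)`. -/
theorem T2At_eq_of_mem_jets {q q' : Rho 𝔸}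
    (hq : q ∈ jets (fun x => logOnePlus (PhiA ρ (Uf W B B' x) (Ub W B B' x) L μ y
      * Ring.inverse (PhiA ρ (Uf 0 B B' x) (Ub 0 B B' x) L μ y) - 1)))
    (hq' : q' ∈ jets (fun x => logOnePlus (PhiA ρ (Uf W B' B x) (Ub W B' B x) L μ y
      * Ring.inverse (PhiA ρ (Uf 0 B' B x) (Ub 0 B' B x) L μ y) - 1))) :
    T2At ℂ ρ (upF W) B B' L μ y = c11 q.snd + c11 q'.snd := by
  rw [eq_dmk_QjetAt ρ W B B' L μ y hq, eq_dmk_QjetAt ρ W B' B L μ y hq', snd_dmk, snd_dmk, T2At]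

/-- [folklore] THE IDENTIFICATION OF THE MIXED JET: 12b's `logT( Φ^ρ_b(U_m) · Φ^ρ_b(U_m|_{W=V=0})⁻¹ )` is the
multilinear 3-jet of the genuine mixed-chart function, so `MjetAt ℂ ρ W V B L μ y` is its `s t₁ t₂`-coefficient. -/
theorem logT_PhiMAt_mem_jets : logT ℂ (PhiMAt ℂ ρ W V B L μ y * invT (PhiMAt ℂ ρ 0 0 B L μ y)) ∈ jets (fun x =>
    logOnePlus (PhiA ρ (Um W V B x) (Umb W V B x) L μ y
      * Ring.inverse (PhiA ρ (Um 0 0 B x) (Umb 0 0 B x) L μ y) - 1)) :=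
  logOnePlus_mul_inverse_mem_jets (PhiMAt_mem_jets ρ W V B L μ y) (PhiMAt_mem_jets ρ 0 0 B L μ y)
    (augR_PhiMAt ρ W V B L μ y) (augR_PhiMAt ρ 0 0 B L μ y)

/-- [folklore] `MjetAt` as the `s t₁ t₂`-Taylor coefficient of the genuine mixed-chart function (any jet). -/
theorem MjetAt_eq_of_mem_jets {q : Rho 𝔸} (hq : q ∈ jets (fun x =>
    logOnePlus (PhiA ρ (Um W V B x) (Umb W V B x) L μ y
      * Ring.inverse (PhiA ρ (Um 0 0 B x) (Umb 0 0 B x) L μ y) - 1))) :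
    MjetAt ℂ ρ W V B L μ y = c11 q.snd := by
  rw [mem_jets_unique hq (logT_PhiMAt_mem_jets ρ W V B L μ y), MjetAt]

end Identification

end Summit.QuantumFields.BalabanUV.Beta.MultilinearJet

end
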